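import Mathlib
import Literature.NumberTheory.LFunctions.Zhang2022.AppendixBLemma151Mu1Edge
import Literature.NumberTheory.LFunctions.Zhang2022.AppendixBLineShiftGeneric
import Literature.NumberTheory.LFunctions.Zhang2022.AppendixBLineToCircleGeneric
import Literature.NumberTheory.LFunctions.Zhang2022.AppendixBLemma151Mu2
import Literature.NumberTheory.LFunctions.Zhang2022.AppendixBTailB3Residue
import HarnessLib

/-!
# Zhang (2022) App. B, proof of Lemma 15.1, `μ = 1`: `Typed.AppendixB.StepB_u012R` DISCHARGED —
# "The same argument also gives `Σ_l ϰ₁(l₁l)ϱ_j(l)/l = e′_{1j} + O(α₁)`" is a theorem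

Topic `Literature/NumberTheory/LFunctions/Zhang2022` (Landau–Siegel audit tree; verdict-neutral).
Y. Zhang, *Discrete mean estimates and the Landau–Siegel zero*, arXiv:2211.02515v1 (2022)
[Zhang2022LandauSiegel] — **an unrefereed manuscript under adjudication; this file PROVES one display
of its Appendix B and asserts nothing about its Theorems 1–2 or Landau–Siegel zeros.** ZHANG-L
discharge lane (WP15, App. B leg B4 under leaf `Typed.Section15C.Eq15_22` → `Eq15_22E e1ppD`,
Lemma 15.1 χR(E); seat zl-w09-p5). DAG node `Z22:§B.u012` [Z22 p.107, tex L5311], reading of record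
`α₁ = α log T` (`Typed.AppendixB.StepB_u012R`).

* `stepB_u012R_holds : Typed.AppendixB.StepB_u012R c′` — for `D` large, `j ∈ {1,2,3}`, `1 ≤ l₁ < T`,
  `‖Σ_l ϰ₁(l₁l)ϱ_j(l)/l − e′_{1j}‖ ≤ C·α₁`. Composition BY NAME of the lane's App. B chain at
  `(P₁, β₆)`: the generic line→circle bound `vline_sub_circle_le_of_shift` (zl-libA-p6,
  `AppendixBLineToCircleGeneric`) fed with the generic vertical-line shift / integrability
  `vline_shift_zetaRatio_kerB`, `integrable_zetaRatio_kerB_line` (zl-closer-4, `AppendixBLineShiftGeneric`),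
  instantiated at `Pμ = P₁`, `β = β₆` (side facts: `log P₁ = 0.504𝓛⁹ ≥ 𝓛⁹/4`, `T² ≤ P₁` so
  `P₁/l₁ ≥ T` for `l₁ < T`, `β₆ ≠ 0`, `β₆ ≠ β_j` and `‖β₆‖ = 3α/2 ≤ 3α` by `beta6_size`, `Re β₆ = 0`,
  `α ≤ α₁`), then `stepB_u012R_of_lineToCircle` (`AppendixBLemma151Mu1Edge`: Perron identity
  `Skeleton.vkSum_vk1_eq_vline`, circles/residue at `0` `AppendixBLemma151Mu1Circles`, `β₆`-value
  `AppendixBLemma151Mu1Value`).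
* `lemma151ChiRE_e1ppD_of_legs` — with B4 discharged, Lemma 15.1 in the χ-reading of record
  (`Skeleton.Lemma151ChiRE e1ppD c′`) needs only the legs `StepB_mu2R`, `StepB_mu3R`, `StepB_u015bR`;
  `lemma151ChiRE_e1ppD_of_mu3R` — with B1 (`Skeleton.stepB_mu2R_holds`, zl-w15-p3) and B5b
  (`AppendixBVarrho.stepB_u015bR_holds`, zl-w15-p8) also theorems, it needs ONLY `StepB_mu3R` (B3).

## References

* Y. Zhang, arXiv:2211.02515v1 (2022), App. B p. 107; §15 Lemma 15.1 p. 80; §2 (2.21)–(2.22).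
  [cite: Zhang2022LandauSiegel, App. B p.107]
-/

noncomputable section

open Complex Real

namespace Literature.NumberTheory.LFunctions.Zhang2022.Skeleton

open Typed.AppendixB (zetaRatio kerB vline vline_sub_circle_le_of_shift integrable_zetaRatio_kerB_line
  vline_shift_zetaRatio_kerB)

section Mu1Holds

variable (c' : ℝ)

/-- `L₀ ≤ log D` once `D ≥ ⌈exp L₀⌉₊`. [folklore] -/
private theorem le_ell_of_ceil_exp_le₇ {L₀ : ℝ} {D : ℕ} (hD : ⌈Real.exp L₀⌉₊ ≤ D) : L₀ ≤ ell D := by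
  have h : Real.exp L₀ ≤ D := le_trans (Nat.le_ceil _) (by exact_mod_cast hD)
  exact (Real.le_log_iff_exp_le (lt_of_lt_of_le (Real.exp_pos _) h)).mpr h

/-- `T² ≤ P₁` for `𝓛 ≥ 2` (`2𝓛^{1.1} ≤ 2𝓛² ≤ 0.504𝓛⁹`), hence `T ≤ P₁/l₁` for `1 ≤ l₁ < T`.
[cite: Zhang2022LandauSiegel, §2 (2.21); §6 (`T`)] -/
private theorem bigT_le_P1_div {D : ℕ} (hℓ : 2 ≤ ell D) {l₁ : ℕ} (hl₁ : 1 ≤ l₁)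
    (hT : (l₁ : ℝ) < bigT D) : bigT D ≤ P1 D / l₁ := by
  have hℓ1 : 1 ≤ ell D := by linarith
  have hℓ0 : 0 < ell D := by linarith
  have hl₁0 : (0 : ℝ) < l₁ := by exact_mod_cast hl₁
  have hT0 : 0 < bigT D := Real.exp_pos _
  have hP1exp : P1 D = Real.exp (0.504 * ell D ^ 9) := by
    have hP : 0 < P1 D := by rw [P1]; exact Real.rpow_pos_of_pos (Real.exp_pos _) _
    rw [← log_P1_mu1 D, Real.exp_log hP]
  have h11 : ell D ^ (1.1 : ℝ) ≤ ell D ^ 2 := by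
    calc ell D ^ (1.1 : ℝ) ≤ ell D ^ (2 : ℝ) := Real.rpow_le_rpow_of_exponent_le hℓ1 (by norm_num)
      _ = ell D ^ 2 := by norm_cast
  have hℓ7 : (128 : ℝ) ≤ ell D ^ 7 := le_trans (by norm_num) (pow_le_pow_left₀ (by norm_num) hℓ 7)
  have h2 : 2 * ell D ^ (1.1 : ℝ) ≤ 0.504 * ell D ^ 9 := by
    have h' : 128 * ell D ^ 2 ≤ ell D ^ 9 := by
      have := mul_le_mul_of_nonneg_left hℓ7 (pow_pos hℓ0 2).le
      have e : ell D ^ 2 * ell D ^ 7 = ell D ^ 9 := by ring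
      linarith only [this, e]
    nlinarith only [h11, h', pow_nonneg hℓ0.le 2]
  have hTT : bigT D * bigT D ≤ P1 D := by
    rw [bigT, ← Real.exp_add, hP1exp, Real.exp_le_exp]
    linarith only [h2]
  rw [le_div_iff₀ hl₁0]
  calc bigT D * l₁ ≤ bigT D * bigT D := mul_le_mul_of_nonneg_left hT.le hT0.le
    _ ≤ P1 D := hTT

/-- The `μ = 1` instance of the lane's generic App. B line→circle bound, in the shape consumed by
`stepB_u012R_of_lineToCircle` (rate `α₁ ≥ α`): for `D` large, `j ∈ {1,2,3}`, `1 ≤ l₁ < T`,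
`‖(1/2πi)∫_{(1)} ζ(1+s)/ζ(1+s−β_j)·(P₁/l₁)ˢ/((log P₁)(s−β₆)²) ds − (2πi)⁻¹∮_{|s|=5α}(same)‖ ≤ C·α₁`.
(Private: the citable generic statement is `Typed.AppendixB.vline_sub_circle_le_of_shift`; the public
per-μ instances are zl-libA-p6's `AppendixBLineToCircle`.) [cite: Zhang2022LandauSiegel, App. B p.107] -/
private theorem vline_sub_circle_le_P1_beta6 : ∃ C : ℝ, ForAllLarge fun D _ _ =>
    ∀ j ∈ ({1, 2, 3} : Finset ℕ), ∀ l₁ : ℕ, 1 ≤ l₁ → l₁ ∈ nset (frakq D) → (l₁ : ℝ) < bigT D →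
      ‖vline 1 (fun s => zetaRatio c' D j s * kerB (P1 D) (beta6 D) l₁ s) -
          (2 * π * I)⁻¹ * (∮ s in C((0 : ℂ), 5 * alpha D), zetaRatio c' D j s * kerB (P1 D) (beta6 D) l₁ s)‖ ≤
        C * alpha1 D := by
  obtain ⟨C, D₀, h⟩ := vline_sub_circle_le_of_shift c' (integrable_zetaRatio_kerB_line c')
    (vline_shift_zetaRatio_kerB c')
  obtain ⟨δ, hδ, K, hK, -⟩ := zeta1_near_one
  refine ⟨max C 0, max D₀ (max 8 ⌈Real.exp (max (max 2 (60 * |c'| * π)) (max (10 * π / δ) (8 * K * π)))⌉₊),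
    fun D _ χ hD _ _ j hj l₁ hl₁ _ hT => ?_⟩
  have hD₀ : D₀ ≤ D := le_trans (le_max_left _ _) hD
  have hD8 : 8 ≤ D := le_trans (le_max_left _ _) (le_trans (le_max_right _ _) hD)
  obtain ⟨hℓ2, hc, -, -, hα0, -, -⟩ := large_package c' hδ hK
    (le_ell_of_ceil_exp_le₇ (le_trans (le_max_right _ _) (le_trans (le_max_right _ _) hD)))
  obtain ⟨hb6, hn6⟩ := beta6_size c' hℓ2 hc hj
  have hℓ1 : 1 ≤ ell D := by linarith
  have hℓ0 : 0 < ell D := by linarith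
  -- the hypotheses of the generic bound at `(P₁, β₆)`
  have hP : 1 < P1 D := one_lt_P1_mu1 D hD8
  have hlog : ell D ^ 9 / 4 ≤ Real.log (P1 D) := by
    rw [log_P1_mu1]; nlinarith [pow_pos hℓ0 9]
  have hTP : bigT D ≤ P1 D / l₁ := bigT_le_P1_div hℓ2 hl₁ hT
  have hβ0 : beta6 D ≠ 0 := by
    intro h0; rw [h0, norm_zero] at hn6; linarith
  have hβb : beta6 D ≠ betaJ c' D j := by
    intro h0; rw [h0, sub_self, norm_zero] at hb6; linarith
  have hβre : (beta6 D).re = 0 := by simp [beta6]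
  have hβ3 : ‖beta6 D‖ ≤ 3 * alpha D := by rw [hn6]; linarith
  have hmain := h D hD₀ j hj (P1 D) l₁ (beta6 D) hP hlog hl₁ hTP hβ0 hβb hβre hβ3
  -- `C·α ≤ max C 0 · α₁`
  have hαα1 : alpha D ≤ alpha1 D := by
    rw [alpha1, log_bigT]
    have : (1 : ℝ) ≤ ell D ^ (1.1 : ℝ) := Real.one_le_rpow hℓ1 (by norm_num)
    nlinarith
  calc _ ≤ C * alpha D := hmain
    _ ≤ max C 0 * alpha D := mul_le_mul_of_nonneg_right (le_max_left _ _) hα0.le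
    _ ≤ max C 0 * alpha1 D := mul_le_mul_of_nonneg_left hαα1 (le_max_right _ _)

/-- **`Z22:§B.u012` is a theorem** (reading of record `α₁ = α log T`): `Typed.AppendixB.StepB_u012R c′` —
for `D` large, every `j ∈ {1,2,3}` and `1 ≤ l₁ < T` (`l₁ ∈ 𝔫(𝔮)`),
`‖Σ_l ϰ₁(l₁l)ϱ_j(l)/l − e′_{1j}‖ ≤ C·α₁` ("The same argument also gives
`Σ_l ϰ₁(l₁l)ϱ_j(l)/l = (1 − 2j/3 + j/(1.134πi))exp{0.756πi} − j/(1.134πi) + O(α₁)`", App. B p. 107).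
The WP15-PLAN leg B4 of Lemma 15.1 χR(E) / leaf h15_22 (`eq15_22D_of_appB_legs`).
[cite: Zhang2022LandauSiegel, App. B p.107] -/
theorem stepB_u012R_holds : Typed.AppendixB.StepB_u012R c' :=
  stepB_u012R_of_lineToCircle c' (vline_sub_circle_le_P1_beta6 c')

/-- `StepB_u012R` — `_holds` alias of `stepB_u012R_holds` above under the fact's exact name (appended
2026-08-28, D-0026 bookkeeping: the proof term is the existing theorem of this file; no statement,
definition or attribute is edited; no new named fact; the ledger's debt table listed the fact
unproved). [cite: Zhang2022LandauSiegel, App. B p.107] -/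
theorem _root_.Literature.NumberTheory.LFunctions.Zhang2022.Typed.AppendixB.StepB_u012R_holds :
    Typed.AppendixB.StepB_u012R c' :=
  _root_.Literature.NumberTheory.LFunctions.Zhang2022.Skeleton.stepB_u012R_holds (c' := c')

/-- Lemma 15.1 in the χ-reading of RECORD (`Skeleton.Lemma151ChiRE e1ppD c′`, R-28) from the three
remaining Appendix-B legs `StepB_mu2R`, `StepB_mu3R`, `StepB_u015bR` (B4 = `StepB_u012R` and B5a =
`StepB_u015aR` being theorems): the by-name input of `eq15_22E_of_lemma151ChiRE` (h15_22E),
`step16_u035LwE_of_lemma151ChiRE` (h16_16R2E) and the §17 E-port (h17_9RelE).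
[cite: Zhang2022LandauSiegel, Lemma 15.1 p.80; App. B] -/
theorem lemma151ChiRE_e1ppD_of_legs
    (hmu2 : Typed.AppendixB.StepB_mu2R c') (hmu3 : Typed.AppendixB.StepB_mu3R c')
    (h15b : Typed.AppendixB.StepB_u015bR c') : Lemma151ChiRE e1ppD c' :=
  lemma151ChiRE_e1ppD_of_appB_legs c' hmu2 hmu3 (stepB_u012R_holds c') h15b

/-- Lemma 15.1 in the χ-reading of RECORD from the LAST open Appendix-B leg: with B1
(`Skeleton.stepB_mu2R_holds`), B4 (`stepB_u012R_holds`), B5a/B5b (`stepB_u015aR_holds`,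
`AppendixBVarrho.stepB_u015bR_holds`) theorems, `StepB_mu3R c′ → Skeleton.Lemma151ChiRE e1ppD c′`.
[cite: Zhang2022LandauSiegel, Lemma 15.1 p.80; App. B] -/
theorem lemma151ChiRE_e1ppD_of_mu3R (hmu3 : Typed.AppendixB.StepB_mu3R c') : Lemma151ChiRE e1ppD c' :=
  lemma151ChiRE_e1ppD_of_legs c' (stepB_mu2R_holds c') hmu3 (AppendixBVarrho.stepB_u015bR_holds c')

end Mu1Holds

end Literature.NumberTheory.LFunctions.Zhang2022.Skeleton
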